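import Mathlib
import Summits.ValiantsHypothesis.ValiantsHypothesis.Theorems.KPlusLogSqLawWeakLiftingTowerGraftSignedCrossingIVT

/-!
# Tower graft line — SIGNED CROSSINGS XIII: the EULER SIGNATURE LAW for a symmetric lacunary pencil (the MatrixDescartes object)

Structure file for LINE (B) `Cruxes/WeakLifting/Lines/tower_graft.lean` (crux `WeakLifting` = stmt-ValiantsHypothesis-19561),
thirteenth of the SIGNED-CROSSING series: files VIII–XI specialised to the general exponent family `H u = Σ_l u^{e_l}•T_l` (a real symmetric
lacunary pencil — the object of `MatrixDescartes`, stmt-18050, and of Conjecture B).  At a root `t > 0` the crossing form is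
`vᵀ(θH)(t)v / t` with `θH = Σ_l e_l u^{e_l} T_l` (file IV), and on the kernel every Euler shift `(θ − c)H` has the same form; so the data at a
root are frames in `ker H(t)` on which `θH(t)` is positive (`Qp`) or negative (`Qm`).

§1 `family_crossing_frames` — `θH`-positive (negative) kernel frames are positive (negative) frames for the entrywise derivative.
§2 ★★ `family_signature` — EULER SIGNATURE LAW (regular kernels): `0 < a ≤ b` non-roots, `T ⊆ (a, b)` finite containing the roots, complete
   `θH`-frames at each root ⇒ `Σ_t |κp t| + ν₋(H b) = Σ_t |κm t| + ν₋(H a)`; ★ `family_signature_degenerate` (any partial frames: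
   `Σ 2|κp| + ν₋(H b) ≤ Σ ν₀ + ν₋(H a)` and the mirror).
§3 ★★ `family_net_signature` — NET EULER SIGNATURE OVER `(0, ∞)`: strictly lowest exponent `e_{l₀}`, strictly highest `e_{l₁}`, `T_{l₀}`, `T_{l₁}`
   nonsingular ⇒ thresholds `u₀, u₁ > 0` such that for every zone `[a, b]` with `0 < a ≤ u₀`, `u₁ ≤ b` and complete `θH`-frames at the roots in
   `(a, b)` (= all positive roots): `Σ_t |κp t| + ν₋(T_{l₁}) = Σ_t |κm t| + ν₋(T_{l₀})` — THE SIGNED COUNT OF THE POSITIVE ROOTS OF A SYMMETRIC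
   LACUNARY PENCIL IS `ν₋(lowest letter) − ν₋(highest letter)`, the exact matrix form of Descartes' parity rule.
READING (honest): the unsigned count — the census quantity `ζ` — is the signed count plus twice the `θH`-negative kernel mass (plus fold slack,
file IX); nothing here bounds that mass: MatrixDescartes (18050), Conjecture B, WeakLifting (19561), S4/S5, TowerB untouched; no census row
moves; VP ≠ VNP NOT proved.  Def-free; Mathlib + files I–XII.  Seat: prover val-sym-lift-p2 g24, `--supports stmt-ValiantsHypothesis-19561
--as helper`.  [folklore spectral flow; the packaging is this work]
-/

-- `Summit.ValiantsHypothesis.ValiantsHypothesis.…` repeats a component by the D-0017 layout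
-- (single-conjunct summit), which the `dupNamespace` linter flags; the name is mandated.
set_option linter.dupNamespace false
set_option autoImplicit false

namespace Summit.ValiantsHypothesis.ValiantsHypothesis.Theorems.KPlusLogSqLaw.TowerGraft

open Matrix Finset Filter Polynomial
open scoped BigOperators Topology

namespace SignedCrossing

variable {ι : Type} [Fintype ι] [DecidableEq ι] {κ : Type} [Fintype κ] [DecidableEq κ]

/-! ## §1 `θH`-frames are crossing frames -/

omit [DecidableEq ι] [DecidableEq κ] in
/-- for `t > 0` and a frame `Q` (any vectors): `θH(t)` positive on `col Q ∖ 0` ⇒ the entrywise derivative `Σ_l (e_l t^{e_l−1})•T_l` is positive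
there; negative ⇒ negative. [this work] -/
theorem family_crossing_frames (e : κ → ℕ) (Tm : κ → Matrix ι ι ℝ) {t : ℝ} (ht : 0 < t) {κ' : Type} [Fintype κ'] (Q : Matrix ι κ' ℝ) :
    ((∀ c : κ' → ℝ, c ≠ 0 → 0 < (Q *ᵥ c) ⬝ᵥ (∑ l, ((e l : ℝ) * t ^ e l) • Tm l) *ᵥ (Q *ᵥ c)) →
      ∀ c : κ' → ℝ, c ≠ 0 → 0 < (Q *ᵥ c) ⬝ᵥ (∑ l, ((e l : ℝ) * t ^ (e l - 1)) • Tm l) *ᵥ (Q *ᵥ c)) ∧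
    ((∀ c : κ' → ℝ, c ≠ 0 → (Q *ᵥ c) ⬝ᵥ (∑ l, ((e l : ℝ) * t ^ e l) • Tm l) *ᵥ (Q *ᵥ c) < 0) →
      ∀ c : κ' → ℝ, c ≠ 0 → (Q *ᵥ c) ⬝ᵥ (∑ l, ((e l : ℝ) * t ^ (e l - 1)) • Tm l) *ᵥ (Q *ᵥ c) < 0) := by
  constructor
  · intro hpos c hc
    have h1 := hpos c hc
    rw [← mul_crossingForm_eq e Tm t (Q *ᵥ c)] at h1
    exact pos_of_mul_pos_right h1 ht.le
  · intro hneg c hc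
    have h1 := hneg c hc
    rw [← mul_crossingForm_eq e Tm t (Q *ᵥ c)] at h1
    exact lt_of_not_ge fun hge => absurd h1 (not_lt.mpr (mul_nonneg ht.le hge))

/-! ## §2 The Euler signature law on a zone -/

omit [DecidableEq κ] in
/-- **EULER SIGNATURE LAW (regular kernels).**  `H u = Σ_l u^{e_l}•T_l` with symmetric letters, `0 < a ≤ b`, `det H(a) ≠ 0 ≠ det H(b)`,
`T ⊆ (a, b)` finite containing the roots; at each `t ∈ T` frames `Qp t` / `Qm t` in `ker H(t)` on which `θH(t) = Σ_l e_l t^{e_l} T_l` is positive /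
negative, with `|κp t| + |κm t| = ν₀(H t)`.  Then `Σ_t |κp t| + ν₋(H b) = Σ_t |κm t| + ν₋(H a)`. [this work] -/
theorem family_signature (e : κ → ℕ) (Tm : κ → Matrix ι ι ℝ) (hTm : ∀ l, (Tm l).IsSymm) {a b : ℝ} (ha : 0 < a) (hab : a ≤ b)
    (ha0 : (∑ l, (a ^ e l) • Tm l).det ≠ 0) (hb0 : (∑ l, (b ^ e l) • Tm l).det ≠ 0)
    (T : Finset ℝ) (hT : ∀ t ∈ T, a < t ∧ t < b) (hcov : ∀ u, a < u → u < b → (∑ l, (u ^ e l) • Tm l).det = 0 → u ∈ T)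
    (κp κm : ℝ → Type) [∀ t, Fintype (κp t)] [∀ t, Fintype (κm t)]
    (Qp : ∀ t, Matrix ι (κp t) ℝ) (Qm : ∀ t, Matrix ι (κm t) ℝ)
    (hQpker : ∀ t ∈ T, ∀ c : κp t → ℝ, (∑ l, (t ^ e l) • Tm l) *ᵥ (Qp t *ᵥ c) = 0)
    (hQp : ∀ t ∈ T, ∀ c : κp t → ℝ, c ≠ 0 → 0 < (Qp t *ᵥ c) ⬝ᵥ (∑ l, ((e l : ℝ) * t ^ e l) • Tm l) *ᵥ (Qp t *ᵥ c))
    (hQmker : ∀ t ∈ T, ∀ c : κm t → ℝ, (∑ l, (t ^ e l) • Tm l) *ᵥ (Qm t *ᵥ c) = 0)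
    (hQm : ∀ t ∈ T, ∀ c : κm t → ℝ, c ≠ 0 → (Qm t *ᵥ c) ⬝ᵥ (∑ l, ((e l : ℝ) * t ^ e l) • Tm l) *ᵥ (Qm t *ᵥ c) < 0)
    (hreg : ∀ t ∈ T, Fintype.card (κp t) + Fintype.card (κm t) =
      (univ.filter fun i => (SteepZone.isHermitian_family (fun l => t ^ e l) Tm hTm).eigenvalues i = 0).card) :
    (∑ t ∈ T, Fintype.card (κp t)) + (univ.filter fun i => (SteepZone.isHermitian_family (fun l => b ^ e l) Tm hTm).eigenvalues i < 0).card =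
      (∑ t ∈ T, Fintype.card (κm t)) + (univ.filter fun i => (SteepZone.isHermitian_family (fun l => a ^ e l) Tm hTm).eigenvalues i < 0).card := by
  have hpos : ∀ t ∈ T, 0 < t := fun t ht => ha.trans (hT t ht).1
  exact sum_card_pos_add_negCount_eq_sum_card_neg_add_negCount (fun u => ∑ l, (u ^ e l) • Tm l)
    (fun u => ∑ l, ((e l : ℝ) * u ^ (e l - 1)) • Tm l) (fun u => SteepZone.isHermitian_family (fun l => u ^ e l) Tm hTm)
    (fun u _ _ i j => hasDerivAt_family e Tm u i j) hab ha0 hb0 T hT hcov κp κm Qp Qm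
    hQpker (fun t ht => (family_crossing_frames e Tm (hpos t ht) (Qp t)).1 (hQp t ht))
    hQmker (fun t ht => (family_crossing_frames e Tm (hpos t ht) (Qm t)).2 (hQm t ht)) hreg

omit [DecidableEq κ] in
/-- **EULER SIGNATURE LAW, DEGENERATE-TOLERANT**: same with ANY partial frames (no completeness):
`Σ 2|κp| + ν₋(H b) ≤ Σ ν₀ + ν₋(H a)` and `Σ 2|κm| + ν₋(H a) ≤ Σ ν₀ + ν₋(H b)`. [this work] -/
theorem family_signature_degenerate (e : κ → ℕ) (Tm : κ → Matrix ι ι ℝ) (hTm : ∀ l, (Tm l).IsSymm) {a b : ℝ} (ha : 0 < a) (hab : a ≤ b)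
    (ha0 : (∑ l, (a ^ e l) • Tm l).det ≠ 0) (hb0 : (∑ l, (b ^ e l) • Tm l).det ≠ 0)
    (T : Finset ℝ) (hT : ∀ t ∈ T, a < t ∧ t < b) (hcov : ∀ u, a < u → u < b → (∑ l, (u ^ e l) • Tm l).det = 0 → u ∈ T)
    (κp κm : ℝ → Type) [∀ t, Fintype (κp t)] [∀ t, Fintype (κm t)]
    (Qp : ∀ t, Matrix ι (κp t) ℝ) (Qm : ∀ t, Matrix ι (κm t) ℝ)
    (hQpker : ∀ t ∈ T, ∀ c : κp t → ℝ, (∑ l, (t ^ e l) • Tm l) *ᵥ (Qp t *ᵥ c) = 0)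
    (hQp : ∀ t ∈ T, ∀ c : κp t → ℝ, c ≠ 0 → 0 < (Qp t *ᵥ c) ⬝ᵥ (∑ l, ((e l : ℝ) * t ^ e l) • Tm l) *ᵥ (Qp t *ᵥ c))
    (hQmker : ∀ t ∈ T, ∀ c : κm t → ℝ, (∑ l, (t ^ e l) • Tm l) *ᵥ (Qm t *ᵥ c) = 0)
    (hQm : ∀ t ∈ T, ∀ c : κm t → ℝ, c ≠ 0 → (Qm t *ᵥ c) ⬝ᵥ (∑ l, ((e l : ℝ) * t ^ e l) • Tm l) *ᵥ (Qm t *ᵥ c) < 0) :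
    (∑ t ∈ T, 2 * Fintype.card (κp t)) + (univ.filter fun i => (SteepZone.isHermitian_family (fun l => b ^ e l) Tm hTm).eigenvalues i < 0).card ≤
        (∑ t ∈ T, (univ.filter fun i => (SteepZone.isHermitian_family (fun l => t ^ e l) Tm hTm).eigenvalues i = 0).card) +
          (univ.filter fun i => (SteepZone.isHermitian_family (fun l => a ^ e l) Tm hTm).eigenvalues i < 0).card ∧
      (∑ t ∈ T, 2 * Fintype.card (κm t)) + (univ.filter fun i => (SteepZone.isHermitian_family (fun l => a ^ e l) Tm hTm).eigenvalues i < 0).card ≤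
        (∑ t ∈ T, (univ.filter fun i => (SteepZone.isHermitian_family (fun l => t ^ e l) Tm hTm).eigenvalues i = 0).card) +
          (univ.filter fun i => (SteepZone.isHermitian_family (fun l => b ^ e l) Tm hTm).eigenvalues i < 0).card := by
  have hpos : ∀ t ∈ T, 0 < t := fun t ht => ha.trans (hT t ht).1
  exact two_mul_sum_card_add_negCount_le (fun u => ∑ l, (u ^ e l) • Tm l)
    (fun u => ∑ l, ((e l : ℝ) * u ^ (e l - 1)) • Tm l) (fun u => SteepZone.isHermitian_family (fun l => u ^ e l) Tm hTm)
    (fun u _ _ i j => hasDerivAt_family e Tm u i j) hab ha0 hb0 T hT hcov κp κm Qp Qm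
    hQpker (fun t ht => (family_crossing_frames e Tm (hpos t ht) (Qp t)).1 (hQp t ht))
    hQmker (fun t ht => (family_crossing_frames e Tm (hpos t ht) (Qm t)).2 (hQm t ht))

/-! ## §3 The net Euler signature over `(0, ∞)` -/

/-- **NET EULER SIGNATURE OF A SYMMETRIC LACUNARY PENCIL.**  `e_{l₀} < e_l` (`l ≠ l₀`), `e_l < e_{l₁}` (`l ≠ l₁`), `T_{l₀}`, `T_{l₁}` nonsingular
(Hermitian witnesses `h₀`, `h₁`).  There are thresholds `0 < u₀`, `0 < u₁` such that for every zone `[a, b]` with `0 < a ≤ u₀`, `u₁ ≤ b`, `a ≤ b`,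
every finite `T ⊆ (a, b)` containing the roots, and complete `θH`-frames at the roots:  `Σ_t |κp t| + ν₋(T_{l₁}) = Σ_t |κm t| + ν₋(T_{l₀})`.
[this work] -/
theorem family_net_signature (e : κ → ℕ) (Tm : κ → Matrix ι ι ℝ) (hTm : ∀ l, (Tm l).IsSymm) (l₀ l₁ : κ)
    (hbot : ∀ l, l ≠ l₀ → e l₀ < e l) (htop : ∀ l, l ≠ l₁ → e l < e l₁)
    (h₀ : (Tm l₀).IsHermitian) (hdet₀ : (Tm l₀).det ≠ 0) (h₁ : (Tm l₁).IsHermitian) (hdet₁ : (Tm l₁).det ≠ 0) :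
    ∃ u₀ u₁ : ℝ, 0 < u₀ ∧ 0 < u₁ ∧ ∀ (a b : ℝ), 0 < a → a ≤ u₀ → u₁ ≤ b → a ≤ b →
      ∀ (T : Finset ℝ), (∀ t ∈ T, a < t ∧ t < b) → (∀ u, a < u → u < b → (∑ l, (u ^ e l) • Tm l).det = 0 → u ∈ T) →
      ∀ (κp κm : ℝ → Type) [∀ t, Fintype (κp t)] [∀ t, Fintype (κm t)] (Qp : ∀ t, Matrix ι (κp t) ℝ) (Qm : ∀ t, Matrix ι (κm t) ℝ),
      (∀ t ∈ T, ∀ c : κp t → ℝ, (∑ l, (t ^ e l) • Tm l) *ᵥ (Qp t *ᵥ c) = 0) →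
      (∀ t ∈ T, ∀ c : κp t → ℝ, c ≠ 0 → 0 < (Qp t *ᵥ c) ⬝ᵥ (∑ l, ((e l : ℝ) * t ^ e l) • Tm l) *ᵥ (Qp t *ᵥ c)) →
      (∀ t ∈ T, ∀ c : κm t → ℝ, (∑ l, (t ^ e l) • Tm l) *ᵥ (Qm t *ᵥ c) = 0) →
      (∀ t ∈ T, ∀ c : κm t → ℝ, c ≠ 0 → (Qm t *ᵥ c) ⬝ᵥ (∑ l, ((e l : ℝ) * t ^ e l) • Tm l) *ᵥ (Qm t *ᵥ c) < 0) →
      (∀ t ∈ T, Fintype.card (κp t) + Fintype.card (κm t) =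
        (univ.filter fun i => (SteepZone.isHermitian_family (fun l => t ^ e l) Tm hTm).eigenvalues i = 0).card) →
      (∑ t ∈ T, Fintype.card (κp t)) + (univ.filter fun i => h₁.eigenvalues i < 0).card =
        (∑ t ∈ T, Fintype.card (κm t)) + (univ.filter fun i => h₀.eigenvalues i < 0).card := by
  classical
  obtain ⟨u₁, hu₁, htopu⟩ := exists_inertia_eq_top e Tm hTm l₁ htop hdet₁
  obtain ⟨u₀, hu₀, hbotu⟩ := exists_inertia_eq_bottom e Tm hTm l₀ hbot hdet₀
  have hone0 : (∑ _l : Unit, (1 : ℝ) • Tm l₀) = Tm l₀ := by simp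
  have hone1 : (∑ _l : Unit, (1 : ℝ) • Tm l₁) = Tm l₁ := by simp
  refine ⟨u₀, u₁, hu₀, hu₁, fun a b ha hau hbu hab T hT hcov κp κm _ _ Qp Qm hQpker hQp hQmker hQm hreg => ?_⟩
  obtain ⟨ha0, hνa, -⟩ := hbotu a ha hau
  obtain ⟨hb0, hνb, -⟩ := htopu b hbu
  rw [negCount_congr _ h₀ hone0 (fun x => x < 0)] at hνa
  rw [negCount_congr _ h₁ hone1 (fun x => x < 0)] at hνb
  have h := family_signature e Tm hTm ha hab ha0 hb0 T hT hcov κp κm Qp Qm hQpker hQp hQmker hQm hreg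
  rw [hνa, hνb] at h
  exact h

end SignedCrossing

end Summit.ValiantsHypothesis.ValiantsHypothesis.Theorems.KPlusLogSqLaw.TowerGraft
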